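import Literature.AlgebraicGeometry.Crystalline.PadicAnchorDefs
import Literature.AlgebraicGeometry.HodgeTheory.AtiyahClassTraceReal
import Literature.AlgebraicGeometry.Motives.Jacobian
import Literature.AlgebraicGeometry.Motives.SupersingularAbelianVariety
import Literature.AlgebraicGeometry.Motives.Sweep1

/-!
# Crux `FermatAnchorAssembly` (stmt-HodgeConjecture-14874), line `Sketch` (parallelizable-avatar): shared VOCABULARY of
# the registered stubs (definitions file, `--supports`; nothing here restates the crux or asserts anything)

Route `PadicSemiregularLift` of `HodgeConjecture`; crux
`FermatAnchorAssembly := PadicPridhamSemiregularity → FormalLiftingFromClassLifting → FormalVectorBundlesAlgebraize →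
HodgeFermatVarieties`. The line's skeleton (`Cruxes/FermatAnchorAssembly/Lines/Sketch.lean`, lead 2026-08-16) runs the
route's `p`-adic engine on supersingular anchors (`Literature/AlgebraicGeometry/Crystalline/PadicAnchorDefs`) of the CM
hosts of Fermat type — the powers `J(Cₘ)ᴺ⁺¹` of the Jacobian of the Fermat curve `Cₘ = X¹ₘ` — and reaches `Xⁿₘ` by
Shioda–Katsura domination. Its three registered stubs and the stub-workers' helper files must speak the SAME
predicates, so they are landed once, here, with explicit subjects (predicates, never closed `Prop`s — the closed
stub statements are one-line `∀`s over these, written in the skeleton where the obligations live):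

* `HodgeFermatJacobianPowersAt m C 𝒥` — HC for all powers `J(C)ᴺ⁺¹` of a Jacobian of the complex Fermat curve `C` of
  degree `m` (hypotheses `IsFermatVariety 1 m C`, `IsSmoothProjective 1 C` inside);
* `HasGenuineSpanningAnchor n X` — the complex `n`-fold `X` admits a supersingular `p`-adic anchor that is genuine and
  spanning (`PadicAnchor.Anchor.IsGenuine`, `.SpansHodge`);
* `zeroOneSeedClasses C 𝒴 r`, `ZeroOneSeedsFor C d 𝒴` — the `{0,1}`-SEMIREGULAR analogue (`IsZeroOneSemiregular`, real
  carriers `σ₀ ⊕ σ₁` of `HodgeTheory/AtiyahClassTraceReal`) of `PadicAnchor.starSeedClasses` / `StarSeedsFor`: the seed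
  certificate is semiregularity instead of (⋆), which the crux's hypothesis P1b `PadicPridhamSemiregularity` converts;
* `ZeroOneSeedsAtAnchors n X` — `{0,1}`-seeds at every genuine anchor of `X`;

plus two proved sanity lemmas (`zeroOneSeedClasses_subset_starSeedClasses_of`,
`starSeedsFor_of_zeroOneSeedsFor_of`: `{0,1}`-seeds are (⋆)-seeds granted "semiregular ⇒ (⋆)" on the model, stated
with that implication as an explicit hypothesis so that no route item is consumed here).
Sources for the notions: Bloch–Esnault–Kerz 2014 §1 / Thm 1.3 (seeds, Hodge condition), Buchweitz–Flenner 2003 §5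
(`I`-semiregularity), Shioda–Katsura 1979 (Fermat curves dominate Fermat varieties; supersingular reduction),
line card `Cruxes/FermatAnchorAssembly/Ideas/parallelizable-avatar.md`.
-/

-- `Summit.HodgeConjecture.HodgeConjecture.…` is the tree's mandated summit/problem namespace (single-problem summit).
set_option linter.dupNamespace false

noncomputable section

open CategoryTheory AlgebraicGeometry
open scoped Isocrystal
open Literature.AlgebraicGeometry Literature.AlgebraicGeometry.Motives
  Literature.AlgebraicGeometry.HodgeTheory Literature.AlgebraicGeometry.Crystalline
  Literature.AlgebraicGeometry.Crystalline.PadicAnchor Literature.AlgebraicGeometry.KTheory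

namespace Summit.HodgeConjecture.HodgeConjecture.Cruxes.FermatAnchorAssembly.ParallelizableAvatar

/-! ### Complex side: the hosts -/

/-- **HC for the powers of a Fermat Jacobian**: if `C` is the complex Fermat curve of degree `m`
(`IsFermatVariety 1 m C`, smooth projective) and `𝒥` a Jacobian of `C`, the Hodge conjecture holds for
every power `J(C)ᴺ⁺¹` (`AbelianVariety.powSucc`). A predicate on `(m, C, 𝒥)` (the hosts of the line:
Shioda–Katsura, `Xⁿₘ` is dominated by `Cₘⁿ`). [cite: ShiodaKatsura1979, Thm. 1.7] -/
def HodgeFermatJacobianPowersAt (m : ℕ) (C : SchemeOver ℂ) (𝒥 : Jacobian C) : Prop :=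
  IsFermatVariety 1 m C → IsSmoothProjective 1 C →
    ∀ N : ℕ, HodgeConjectureFor (𝒥.J.powSucc N).dim (𝒥.J.powSucc N).X

/-- **`X` has a genuine, spanning supersingular `p`-adic anchor** (`PadicAnchor.Anchor` with
`IsGenuine` — the classical crystalline / de Rham / period package, Berthelot–Ogus 3.8,
Bloch–Esnault–Kerz 1.3, Lenstra–Zarhin, the model hypotheses of `FormalLiftingFromClassLifting` —
and `SpansHodge`). A predicate on `(n, X)`; intended subjects: CM abelian varieties of Fermat type at
`p ≡ -1 (m)`. [cite: BlochEsnaultKerz2014pAdic, §1 and Thm. 1.3] -/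
def HasGenuineSpanningAnchor (n : ℕ) (X : SchemeOver ℂ) : Prop :=
  ∃ D : Anchor n X, D.IsGenuine ∧ D.SpansHodge

/-! ### `p`-adic side: `{0,1}`-semiregular seeds -/

section Seeds

variable {p : ℕ} [Fact p.Prime] {k : Type} [Field k] [CharP k p] [PerfectRing k p]

/-- The **`{0,1}`-semiregular seed classes** in degree `2r` on the special fibre of `𝒴`, relative to
`C`: crystalline Chern characters `ch_r(E)` of finite locally free `E` that are `{0,1}`-semiregular
(`IsZeroOneSemiregular`: `(σ₀, σ₁)` injective on `Ext²(E,E)`) and satisfy the Bloch–Esnault–Kerz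
Hodge condition in all degrees (`C.HodgeCondition`). [cite: BuchweitzFlenner2003, §5 (I-semiregular)]
[cite: BlochEsnaultKerz2014pAdic, Thm. 1.3 (a)] -/
def zeroOneSeedClasses (C : CrystallineRealization p k) (𝒴 : SchemeOver (WittVector p k)) (r : ℕ) :
    Set (C.obj (WittScheme.specialFibre 𝒴) (2 * r)) :=
  {x | ∃ (E : (WittScheme.specialFibre 𝒴).left.Modules) (hE : IsFiniteLocallyFree E),
      C.HodgeCondition 𝒴 E ∧ IsZeroOneSemiregular hE ∧
        x = C.chCris (WittScheme.specialFibre 𝒴) E r}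

/-- **`{0,1}`-SEEDS for the model `𝒴`** of relative dimension `d`, relative to `C`: every rational
algebraic class of the special fibre in a middle codimension `1 ≤ r < d` whose Berthelot–Ogus image
lies in `Fʳ` is, up to `N ≠ 0`, a `ℤ`-combination of `{0,1}`-semiregular seed classes (the
semiregular form of `PadicAnchor.StarSeedsFor`). [cite: BlochEsnaultKerz2014pAdic, Thm. 1.3] -/
def ZeroOneSeedsFor (C : CrystallineRealization p k) (d : ℕ) (𝒴 : SchemeOver (WittVector p k)) :
    Prop :=
  ∀ (r : ℕ), 1 ≤ r → r < d → ∀ u ∈ C.ratAlgebraicClasses (WittScheme.specialFibre 𝒴) r,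
    C.bo 𝒴 (2 * r) u ∈ C.dR.fil (2 * r) r →
    ∃ N : ℤ, N ≠ 0 ∧ N • u ∈ AddSubgroup.closure (zeroOneSeedClasses C 𝒴 r)

/-- Sanity (proved): granted "`{0,1}`-semiregular ⇒ (⋆)" for the finite locally free modules on the
special fibre of `𝒴` (the shape of the route's P1b at `𝒴`, taken as an explicit hypothesis), every
`{0,1}`-seed class is a (⋆)-seed class. [cite: BlochEsnaultKerz2014pAdic, §1] -/
theorem zeroOneSeedClasses_subset_starSeedClasses_of (C : CrystallineRealization p k)
    {𝒴 : SchemeOver (WittVector p k)}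
    (hstar : ∀ (E : (WittScheme.specialFibre 𝒴).left.Modules) (hE : IsFiniteLocallyFree E),
      IsZeroOneSemiregular hE → ClassLiftsImplyObjectLifts 𝒴 E) (r : ℕ) :
    zeroOneSeedClasses C 𝒴 r ⊆ starSeedClasses C 𝒴 r := by
  rintro x ⟨E, hE, hH, hsr, rfl⟩
  exact ⟨E, hE, hH, hstar E hE hsr, rfl⟩

/-- Sanity (proved): under the same hypothesis, `{0,1}`-seeds for `𝒴` are (⋆)-seeds for `𝒴`.
[cite: BlochEsnaultKerz2014pAdic, §1] -/
theorem starSeedsFor_of_zeroOneSeedsFor_of (C : CrystallineRealization p k) {d : ℕ}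
    {𝒴 : SchemeOver (WittVector p k)}
    (hstar : ∀ (E : (WittScheme.specialFibre 𝒴).left.Modules) (hE : IsFiniteLocallyFree E),
      IsZeroOneSemiregular hE → ClassLiftsImplyObjectLifts 𝒴 E)
    (h : ZeroOneSeedsFor C d 𝒴) : StarSeedsFor C d 𝒴 := by
  intro r h1 hr u hu hfil
  obtain ⟨N, hN, hNu⟩ := h r h1 hr u hu hfil
  exact ⟨N, hN,
    AddSubgroup.closure_mono (zeroOneSeedClasses_subset_starSeedClasses_of C hstar r) hNu⟩


/-- **Registered sub-goal `starSeedsFor_of_zeroOneSeedsFor`** (the sanity lemma as ONE closed statement, all binders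
explicit): on any model, "`{0,1}`-semiregular ⇒ (⋆)" turns `{0,1}`-seeds into (⋆)-seeds. Proof:
`starSeedsFor_of_zeroOneSeedsFor_of`. [cite: BlochEsnaultKerz2014pAdic, §1] -/
theorem starSeedsFor_of_zeroOneSeedsFor : ∀ (p : ℕ) [Fact p.Prime] (k : Type) [Field k] [CharP k p] [PerfectRing k p] (C : CrystallineRealization p k) (d : ℕ) (𝒴 : SchemeOver (WittVector p k)), (∀ (E : (WittScheme.specialFibre 𝒴).left.Modules) (hE : IsFiniteLocallyFree E), IsZeroOneSemiregular hE → ClassLiftsImplyObjectLifts 𝒴 E) → ZeroOneSeedsFor C d 𝒴 → StarSeedsFor C d 𝒴 :=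
  fun _ _ _ _ _ _ C _ _ hstar h => starSeedsFor_of_zeroOneSeedsFor_of C hstar h

end Seeds

/-- **`{0,1}`-seeds at every genuine anchor of `X`**: for every anchor `D : Anchor n X` that is
genuine, `ZeroOneSeedsFor D.C n D.𝒴`. A predicate on `(n, X)`; intended subjects: the powers of the
Fermat Jacobians (the OPEN content of the line is this predicate at those hosts).
[cite: BlochEsnaultKerz2014pAdic, Thm. 1.3] -/
def ZeroOneSeedsAtAnchors (n : ℕ) (X : SchemeOver ℂ) : Prop :=
  ∀ D : Anchor n X, D.IsGenuine → ZeroOneSeedsFor D.C n D.𝒴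

end Summit.HodgeConjecture.HodgeConjecture.Cruxes.FermatAnchorAssembly.ParallelizableAvatar

end
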